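import Literature.MathematicalPhysics.QuantumFieldTheory.Balaban1983to89.B8SectEKLevelInLambdaRec
import Literature.MathematicalPhysics.QuantumFieldTheory.Balaban1983to89.B8Restr129InversionLocalRec
import Literature.MathematicalPhysics.QuantumFieldTheory.Balaban1983to89.B8Eq138LandauZdRec
import Literature.MathematicalPhysics.QuantumFieldTheory.Balaban1983to89.B8Prop5JoinSectELocal

/-!
# `Balaban1983to89.B8Prop5JoinSectERec` — RECORD TWIN of `B8Prop5JoinSectE` §0–§2 + §4 (`exists_Dprime_map`) and `B8Prop5JoinSectELocal` §1 (`restr129_mul_gaugeExp_local`)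
# + §2 (`cond179_of_eq114'`) ([Balaban1985RegularSpaces] Prop. 5 p. 94 joined with Sect. E pp. 95–97 on the INVERSE pair, route (a″)) FOR THE SYMMETRISED CENTRED
# block averaging (0.4) of [Balaban1987RG1]

statement-level skeleton of published theorems with citation tags; proofs where landed; nothing here is a claim about the Yang–Mills mass gap

T. Bałaban, *Spaces of regular gauge field configurations on a lattice and gauge fixing conditions*, Commun. Math. Phys. **99** (1985) 75–102
`[Balaban1985RegularSpaces]` ("[6]"): Prop. 5 (1.107)–(1.109) p. 94, (1.92) p. 91, (1.95)–(1.106) pp. 92–94, (1.112)–(1.121) pp. 95–97, (1.78)–(1.79) p. 90, (1.29) p. 81;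
T. Bałaban, *Averaging operations for lattice gauge theories*, Commun. Math. Phys. **98** (1985) 17–51 `[Balaban1985Averaging]` ("[3]"): Prop. 10 (203)–(214) p. 50,
(166)–(167) p. 44; T. Bałaban, *Propagators for lattice gauge theories in a background field*, Commun. Math. Phys. **99** (1985) 389–434 `[Balaban1985BackgroundPropagators]`
("[4]"): (3.19)–(3.25) pp. 393–394; T. Bałaban, *Renormalization group approach to lattice gauge field theories. I*, Commun. Math. Phys. **109** (1987) 249–301
`[Balaban1987RG1]` ("[I]"): (0.3)–(0.4) pp. 252–253.  STATUS: published, refereed.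

CITATION HEADER (lean-in-tree rule).  Cell `pub-ymgap`, «N05-REC» stage 2 (director-ym №254∕№255∕№288), item R5-γ (Prop 5 join for the record; dag-n05-c's remainder list, HANDOFF g26)
— typed by the LEAD PEN dag-n05-e g39 (inventory `N05-REC-INVENTORY.md` §R5 rows `B8Prop5JoinSectE`: A `exists_Dprime_map`, `sectE_exists`, `sectE_lipschitz`, `sectE_real`;
`B8Prop5JoinSectELocal`: A `cond179_of_eq114'`, `restr129_mul_gaugeExp_local`).  WHAT IS REPRODUCED = ✓ those engine sections (seat `pub-ymgap-dag-n19-b` ∕ `n05-b` lineage)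
VERBATIM under the token map; the engine's JOIN-B∕JOIN-C theorems `hFP_kLevel_of_sectE` ∕ `hFP_kLevel_of179_local` ∕ `hFP_kLevel_of_sectE_local(')` are off the crown's cone
(the crown reads the `…LocalRD` forms, next file) and not twinned.  THEOREM NAMES = the engine's (namespace `…B8Prop5JoinSectERec`).  TOKEN MAP: `Cnl ∕ Qnl ∕ Cond179 ∕ InAx ∕
Restr129 ∕ InLambda ∕ glev ↦ CnlZ ∕ QnlZ ∕ Cond179Z ∕ InAxZ ∕ Restr129Z ∕ InLambdaZ ∕ glevZ`, `QprimeIter (zdBlocking d L) (bgT L U₀) ↦ QprimeIter (zdBlockingZ d L) (bgTZ L U₀)`;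
tower `B8Ineq130.tlo ∕ thi ↦ B8Ineq130Rec.tlo ∕ thi` (CENTRED); regime `(hL : 2 ≤ L) ↦ (hLs : L = 2sL+1) (hs1 : 1 ≤ sL)` (`sL` = the half-side; `s, t` stay the ball
elements of (1.102)), `C0 ↦ C0Z`; the gauge-fixing witness constant `40d·c_B ↦ 20dKZ·c_B` with the record smallness (`exp(4c_Zα₀)(1 + 2·131072(d+1)²KZ²c_B) ≤ 2`,
`KZ·c_B ≤ c₃`, `1024·d·KZ·c_B ≤ 1`).  Record inputs: `B8SectEKLevelInLambdaRec.exists_Dprime_kLevel_inv_of_axial ∕ Dprime_lipschitz_kLevel_inv_of_axial`,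
`B8Restr129InversionLocalRec.restr129_mul_inv_of_cond179_local`, `B8SectEInLambdaWitnessRec.witness_unitary_of_glevZ`, `B8Eq1117KLevelRec.glevZ_on_towers_of_axial`;
structure-free engine inputs REUSED BY NAME (`B8LambdaSpaceKLevel.*`, `B8Prop5GaugeParamKLevel.gpar_size`, `B8Eq1117KLevel.dom120_of_119_tower`, `B8Eq1123Concrete.cj_smul_complex`,
`B8SectEKLevelDomainSeq.mem_of_inBox_tower_of_domainSeq` is NOT used — the engine's `hEbT_of_domainSeq` (corner `DomainSeq`) is off the record path; the sockets derive `hEbT`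
from the centred towers directly).  Kind «kernel-checked proof», theorems only; no `def`, no `instance`, no `notation`, no existing module modified.
`--supports stmt-QuantumFields-20541` (K0⁷-keyed, COUNT-NEUTRAL).

## WHAT IS CERTIFIED HERE (kernel; axioms `propext` ∕ `Classical.choice` ∕ `Quot.sound`)
* §0 private scalar bookkeeping (the structure-free `cjDiff_le_of_weighted`, `covLap_smul` REUSED from the engine); §1 private `ball_sub_119`, `ball_diff_modulus` (the ¼α₄-ball of (1.102) in Sect. E's (1.119), centred towers — private: their statements differ from the engine's only inside `tlo ∕ thi`).
* §2 private `hH1_tower`, `sectE_exists`, `sectE_lipschitz`, `sectE_real` — Sect. E's `D′(u₁⁻¹, −iλ_s)` on the ¼α₄-ball: existence, Lipschitz, reality, record structure.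
* §3 `exists_Dprime_map` — the map `λ ↦ D′(u₁⁻¹, −iλ)` chosen once.
* §4 `restr129_mul_gaugeExp_local` — (1.29) for `u₁·e^{iλ′}` by the LOCAL inversion route, record structure.
* §5 `cond179_of_eq114'` — (1.114) + `Q′λ_s = 0` ⇒ (1.79) for the inverse pair.

HONEST SCOPE: the engine's proofs verbatim under the token map; nothing of Bałaban's analysis newly proved; `HThm4Rec` UNDISCHARGED; caveat (C-S3-1) + addendum v4 stand; N05 [B8]
DISCHARGED OF RECORD untouched; N05 ∕ N07 NOT discharged; COUNT of record unmoved · K numerically unchanged; one finite `𝕋⁴` programme at fixed `ε`, Bałaban AS PRINTED; nothing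
continuum ∕ ℝ⁴ ∕ OS ∕ mass-gap ∕ Clay.  No `sorry`, no `def`.

[cite: Balaban1985RegularSpaces, Prop. 5 (1.107)–(1.109) p.94, (1.92) p.91, (1.95)–(1.106) pp.92–94, (1.112)–(1.121) pp.95–97, (1.78)–(1.79) p.90, (1.29) p.81;
Balaban1985Averaging, Proposition 10 (203)–(214) p.50, (166)–(167) p.44; Balaban1985BackgroundPropagators, (3.19)–(3.25) pp.393–394; Balaban1987RG1, (0.3)–(0.4) pp.252–253]
-/

noncomputable section

open NormedSpace Metric Set Filter Topology
open Complex (I)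

namespace Literature.MathematicalPhysics.QuantumFieldTheory.Balaban1983to89.B8Prop5JoinSectERec

open B7Prop1Explicit (e U1 expUnit val_inv_expUnit)
open B7Prop2Explicit (unitaryUnits mem_unitaryUnits unitaryUnits_le_U1 c2')
open B7Prop2Rec (AvgClosedZ C0Z avgClosedZ_unitaryUnits)
open B7Prop4GeneralLevelsRec (cZ KZ gZ_nonneg)
open B7Prop1Local (InBox pdevOn)
open B7Prop3Flat (expCfg c3)
open B7Eq78Linearization (conjR QprimeIter QprimeIter_smul)
open B7Eq170Flat (cj cj_apply)
open B7Prop10General (C6 C4G)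
open B7Prop10Flat (one_le_C5 C4'_nonneg C5'_nonneg)
open B7Prop9Flat (C5')
open B7Eq214General (Cgen)
open B8Ineq130Rec (tlo thi)
open B7SectCDGaugeAveragesRec (glevZ)
open B7SectEFLinearisationRec (zdBlockingZ bgTZ InLambdaZ)
open B7Eq92Concrete (mgauge)
open B8Eq119TwistedAxialRec (InAxZ Restr129Z)
open B8Eq178AveragesRec (util178Z QnlZ Cond179Z)
open B8Eq1123Concrete (cj_smul_complex)
open B8Eq1123ConcreteRec (CnlZ)
open B8Ineq125Concrete (C2p C2p_nonneg)
open B8Eq1117Concrete (XSpace)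
open B8Eq1117KLevel (dom120_of_119_tower)
open B8DprimeKLevelLipschitz (smallness_prod)
open B8SectEKLevelInLambdaRec (exists_Dprime_kLevel_inv_of_axial Dprime_lipschitz_kLevel_inv_of_axial)
open B8Ineq132 (covDerivFwd covDeriv norm_conjR)
open B8Eq151V2Divergence (eta_smul_covDerivFwd covDerivFwd_smul)
open B8Eq146AExpansion (covDeriv_smul)
open B8Eq138LandauZd (covLap covDivB)
open B8Eq138LandauZdRec (QTZ)
open B8Eq182Proof (gAd)
open B8Eq184Proof (gaugeExp)
open B8Eq188Proof (frakF3)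
open B8LambdaSpaceKLevel (wt wt_pos wt_nonneg lamSubK lamOf lamOf_sub norm_lamOf_le weight_mul_norm_covDerivFwd_le norm_cjDiff_lamOf_le
  norm_le_iff norm_sub_le_iff covDerivFwd_sub')
open B8Prop5JoinHFP (covLap_neg')
open B8Prop5ContractionKLevel (Bd2 Mc Kc)
open B8Prop5KLevelLetters (covLap_sub)
open B8Prop5JoinSectE (cjDiff_le_of_weighted covLap_smul)

-- `Site` alone could resolve to the torus sites of `Setup.lean`; re-export the `ℤ^d` sites of `B7Prop1Explicit`.
export B7Prop1Explicit (Site)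

variable {d : ℕ} {𝔸 : Type*} [CStarAlgebra 𝔸] [Nontrivial 𝔸]

omit [Nontrivial 𝔸] in
/-- The record's gauge-fixing witness constant `20dKZ·c` is non-negative (`KZ = 2(1 + 2g_Z) ≥ 0`). [folklore] -/
private theorem alpha3Z_nonneg (L : ℕ) {c : ℝ} (hc : 0 ≤ c) : 0 ≤ 20 * (d : ℝ) * KZ d L * c := by
  have hK : 0 ≤ KZ d L := by unfold KZ; have := gZ_nonneg d L; positivity
  positivity

/-! ## §0 Bookkeeping: the scalar `−i`, weighted gradients in Sect. E's currency, `Δ(cf) = cΔf` -/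

section Bookkeeping

omit [Nontrivial 𝔸] in
/-- `‖(−i)·a‖ = ‖a‖`. [folklore] -/
private theorem norm_negI_smul (a : 𝔸) : ‖(-I) • a‖ = ‖a‖ := by
  rw [norm_smul, norm_neg, Complex.norm_I, one_mul]

omit [Nontrivial 𝔸] in
/-- `i·((−i)·a) = a` and `(−i)·(i·a) = a`. [folklore] -/
private theorem I_smul_negI_smul (a : 𝔸) : I • ((-I) • a) = a ∧ (-I) • (I • a) = a := by
  constructor <;> rw [smul_smul] <;> simp [Complex.I_mul_I]

omit [Nontrivial 𝔸] in
/-- `((−i)·a)* = i·a*` in a C⋆-algebra. [folklore] -/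
private theorem star_negI_smul (a : 𝔸) : star ((-I) • a) = I • star a := by
  rw [star_smul, star_neg, Complex.star_def, Complex.conj_I, neg_neg]

omit [Nontrivial 𝔸] in
/-- `(−i)·a` is Hermitian when `a* = −a`. [folklore] -/
private theorem isSelfAdjoint_negI_smul_of_skew {a : 𝔸} (ha : star a = -a) : IsSelfAdjoint ((-I) • a) := by
  rw [IsSelfAdjoint, star_negI_smul, ha, smul_neg, ← neg_smul]

omit [Nontrivial 𝔸] in
/-- `((−i)·a)* = −((−i)·a)` when `a` is Hermitian: `−iλ` is skew for Hermitian `λ`. [folklore] -/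
private theorem star_negI_smul_of_sa {a : 𝔸} (ha : IsSelfAdjoint a) : star ((-I) • a) = -((-I) • a) := by
  rw [star_negI_smul, ha.star_eq, neg_smul, neg_neg]

end Bookkeeping

/-! ## §1 The ¼α₄-ball of (1.102) lies in Sect. E's set (1.119) for `λ_E = −iλ`, tower by tower -/

section Ball

variable {L sL k : ℕ} {η : ℝ} {Λs : ℕ → Set (Site d)} {Eb : ℕ → Set (Site d × Fin d)} {U₀ : Site d → Fin d → 𝔸ˣ}

omit [Nontrivial 𝔸] in
/-- **(1.102)-ball ⇒ (1.119) on the towers, for `λ_E := −iλ`** (the (a″) convention of the join, `pub-ymgap-dag-n05-a` RULING INBOX l.11309: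
Sect. E is run on the inverse pair `(e^{−iλ}, u₁⁻¹)` at the same background `U₀`): if `‖s‖ ≤ ¼α₄` and every bond of the tower `Bʲ(y)`,
`y ∈ Λ_j`, is a bond of `Eb j`, then `‖(−iλ_s)(x)‖ < ½α₄` on the tower and `‖R(U₀(b))(−iλ_s)(b₊) − (−iλ_s)(b₋)‖ < ½α₄·L^{−j}` on its bonds.
[cite: Balaban1985RegularSpaces, (1.102) p.93, (1.119) p.96, (1.113) p.95] -/
private theorem ball_sub_119 (hL : 1 ≤ L) (hη : 0 < η) {α₄ : ℝ} (hα₄ : 0 < α₄)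
    (hEbT : ∀ j, j ≤ k → ∀ y ∈ Λs j, ∀ (x : Site d) (κ : Fin d), InBox (tlo L y j) (thi L y j) x →
      InBox (tlo L y j) (thi L y j) (x + e κ) → (x, κ) ∈ Eb j)
    (s : lamSubK η U₀ L k Eb) (hs : ‖s‖ ≤ α₄ / 4) :
    (∀ j, j ≤ k → ∀ y ∈ Λs j, ∀ x : Site d, InBox (tlo L y j) (thi L y j) x → ‖((-I) • lamOf s) x‖ < α₄ / 2) ∧
      ∀ j, j ≤ k → ∀ y ∈ Λs j, ∀ (x : Site d) (κ : Fin d), InBox (tlo L y j) (thi L y j) x →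
        InBox (tlo L y j) (thi L y j) (x + e κ) →
          ‖cj (U₀ x κ) (((-I) • lamOf s) (x + e κ)) - ((-I) • lamOf s) x‖ < α₄ / 2 * ((L : ℝ) ^ j)⁻¹ := by
  refine ⟨fun j _ y _ x _ => ?_, fun j hj y hy x κ hx hxe => ?_⟩
  · rw [Pi.smul_apply, norm_negI_smul]
    exact ((norm_lamOf_le s x).trans hs).trans_lt (by linarith)
  · have hLj : (0 : ℝ) < ((L : ℝ) ^ j)⁻¹ := by
      have : (0 : ℝ) < L := by exact_mod_cast hL
      positivity
    rw [Pi.smul_apply, Pi.smul_apply, cj_smul_complex, ← smul_sub, norm_negI_smul]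
    calc ‖cj (U₀ x κ) (lamOf s (x + e κ)) - lamOf s x‖ ≤ ‖s‖ * ((L : ℝ) ^ j)⁻¹ :=
          norm_cjDiff_lamOf_le hL hη s hj (hEbT j hj y hy x κ hx hxe)
      _ ≤ α₄ / 4 * ((L : ℝ) ^ j)⁻¹ := mul_le_mul_of_nonneg_right hs hLj.le
      _ < α₄ / 2 * ((L : ℝ) ^ j)⁻¹ := mul_lt_mul_of_pos_right (by linarith) hLj

omit [Nontrivial 𝔸] in
/-- **The difference modulus of `λ_E,s − λ_E,t = −i(λ_s − λ_t)` on the towers is `‖s − t‖`** (sites and bonds).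
[cite: Balaban1985RegularSpaces, (1.105)–(1.106) p.94, (1.125) p.97] -/
private theorem ball_diff_modulus (hL : 1 ≤ L) (hη : 0 < η)
    (hEbT : ∀ j, j ≤ k → ∀ y ∈ Λs j, ∀ (x : Site d) (κ : Fin d), InBox (tlo L y j) (thi L y j) x →
      InBox (tlo L y j) (thi L y j) (x + e κ) → (x, κ) ∈ Eb j)
    (s t : lamSubK η U₀ L k Eb) :
    (∀ j, j ≤ k → ∀ y ∈ Λs j, ∀ x : Site d, InBox (tlo L y j) (thi L y j) x → ‖((-I) • lamOf s - (-I) • lamOf t) x‖ ≤ ‖s - t‖) ∧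
      ∀ j, j ≤ k → ∀ y ∈ Λs j, ∀ (x : Site d) (κ : Fin d), InBox (tlo L y j) (thi L y j) x →
        InBox (tlo L y j) (thi L y j) (x + e κ) →
          ‖cj (U₀ x κ) (((-I) • lamOf s - (-I) • lamOf t) (x + e κ)) - ((-I) • lamOf s - (-I) • lamOf t) x‖ ≤
            ‖s - t‖ * ((L : ℝ) ^ j)⁻¹ := by
  have hfun : (-I) • lamOf s - (-I) • lamOf t = (-I) • lamOf (s - t) := by rw [lamOf_sub, smul_sub]
  rw [hfun]
  refine ⟨fun j _ y _ x _ => ?_, fun j hj y hy x κ hx hxe => ?_⟩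
  · rw [Pi.smul_apply, norm_negI_smul]
    exact norm_lamOf_le (s - t) x
  · rw [Pi.smul_apply, Pi.smul_apply, cj_smul_complex, ← smul_sub, norm_negI_smul]
    exact norm_cjDiff_lamOf_le hL hη (s - t) hj (hEbT j hj y hy x κ hx hxe)

end Ball

/-! ## §2 `D′` for `λ_E = −iλ_s` on the ¼α₄-ball: existence, bounds, (1.117) and (1.114) (n05-b's Sect. E BY NAME, inverse pair) -/

section SectE

variable {L sL k : ℕ} {η : ℝ} {Λs : ℕ → Set (Site d)} {Eb : ℕ → Set (Site d × Fin d)} {U₀ : Site d → Fin d → 𝔸ˣ}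
  {B : Site d → Fin d → 𝔸} {u₁ : Site d → 𝔸ˣ} {α₀ αP α₄ c B₀' : ℝ}

omit [Nontrivial 𝔸] in
/-- The tower form of the `H′`-modulus (n05-b's `hH1`) from its `Eb`-weighted form. [cite: Balaban1985RegularSpaces, (1.92) p.91, (1.119) p.96] -/
private theorem hH1_tower (hL1 : 1 ≤ L) (hη : 0 < η) (H' : XSpace d k 𝔸 →ₗ[ℂ] (Site d → 𝔸))
    (hEbT : ∀ j, j ≤ k → ∀ y ∈ Λs j, ∀ (x : Site d) (κ : Fin d), InBox (tlo L y j) (thi L y j) x →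
      InBox (tlo L y j) (thi L y j) (x + e κ) → (x, κ) ∈ Eb j)
    (hH1 : ∀ j, j ≤ k → ∀ (X : XSpace d k 𝔸), ∀ p ∈ Eb j, wt L η j * ‖covDerivFwd η U₀ p.2 (H' X) p.1‖ ≤ B₀' * ‖X‖) :
    ∀ j, j ≤ k → ∀ y ∈ Λs j, ∀ (X : XSpace d k 𝔸) (x : Site d) (κ : Fin d), InBox (tlo L y j) (thi L y j) x →
      InBox (tlo L y j) (thi L y j) (x + e κ) → ‖cj (U₀ x κ) (H' X (x + e κ)) - H' X x‖ ≤ B₀' * ‖X‖ * ((L : ℝ) ^ j)⁻¹ :=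
  fun j hj y hy X x κ hx hxe => cjDiff_le_of_weighted hL1 hη (hH1 j hj X (x, κ) (hEbT j hj y hy x κ hx hxe))

/-- **SECT. E'S `D′(u₁⁻¹, −iλ_s)` ON THE ¼α₄-BALL OF (1.102)** — n04-b's `B8SectEKLevelInLambda.exists_Dprime_kLevel_inv_of_axial` (over n05-b's
`B8Eq1117KLevel`) BY NAME at `λ_E := −iλ_s` for the inverse pair `(·, u₁⁻¹)` of the (a″) ruling (same background `U₀`; every hypothesis AT `u₁`:
the datum's (1.34) `InAx`, (1.29) `Restr129`, (1.69), unitarity and plaquette regularity of `U₁U₀`): there is `X = D′(−iλ_s)` with `‖X‖ ≤ α₄/(2B′₀)`, `‖X‖ ≤ C2p(α₃ + α₄)α₄`, vanishing off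
`𝔅_k`, solving (1.117) `C′_j(u₁⁻¹, −iλ_s − H′X)(y) = X(j, y)` on `𝔅_k`, and (1.114) `Q′_j(u₁⁻¹, e^{−iλ_s − H′X})(y) = (Q′_j(−iλ_s))(y)` there.
Tower-local regime as in n04-b/n05-b ((1.33) on `Bʲ(y)`, (1.69) `|B_b| ≤ c L^{−j}`, `H′`'s (1.92)₁,₂ and `Q′H′ = I` on `𝔅_k`, the eight windows,
`2048·d·c ≤ 1`, print's «α₃ + α₄ ≦ 1/(4B′₀C′₂)»); tower bonds in `Eb j`.
[cite: Balaban1985RegularSpaces, (1.113)–(1.121) pp.95–97, (1.92) p.91, (1.102) p.93; Balaban1985Averaging, (213)–(214) p.50] -/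
theorem sectE_exists (hLs : L = 2 * sL + 1) (hs1 : 1 ≤ sL) (hη : 0 < η) (hU₀ : ∀ x κ, U₀ x κ ∈ unitaryUnits 𝔸) (H' : XSpace d k 𝔸 →ₗ[ℂ] (Site d → 𝔸))
    (hα : 0 < α₀) (hα3 : C0Z d * α₀ ≤ 1 / 3) (hα4 : 4 * α₀ ≤ c2' d L) (hc : 0 ≤ c) (hα₄ : 0 < α₄) (hB : 0 < B₀')
    (h33 : ∀ j, j ≤ k → ∀ y ∈ Λs j, pdevOn (tlo L y j) (thi L y j) U₀ < α₀ * (((L : ℝ) ^ j)⁻¹) ^ 2)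
    (h69 : ∀ j, j ≤ k → ∀ y ∈ Λs j, ∀ (x : Site d) (κ : Fin d), InBox (tlo L y j) (thi L y j) x →
      InBox (tlo L y j) (thi L y j) (x + e κ) → ‖B x κ‖ ≤ c * ((L : ℝ) ^ j)⁻¹)
    (hd : 1 ≤ d) (hαP : 0 < αP) (hαP3 : C0Z d * αP ≤ 1 / 3) (hαP2 : 2 * αP ≤ c2' d L)
    (hBu : ∀ (x : Site d) (κ : Fin d), expCfg B x κ ∈ unitaryUnits 𝔸)
    (hP : ∀ j, j ≤ k → ∀ y ∈ Λs j, pdevOn (tlo L y j) (thi L y j) (expCfg B * U₀) < αP * (((L : ℝ) ^ j)⁻¹) ^ 2)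
    (hAx : InAxZ L k Λs U₀ (mgauge U₀ u₁ (expCfg B) * U₀)) (h129 : Restr129Z L k Λs U₀ u₁)
    (hEbT : ∀ j, j ≤ k → ∀ y ∈ Λs j, ∀ (x : Site d) (κ : Fin d), InBox (tlo L y j) (thi L y j) x →
      InBox (tlo L y j) (thi L y j) (x + e κ) → (x, κ) ∈ Eb j)
    (hH0 : ∀ (X : XSpace d k 𝔸) (x : Site d), ‖H' X x‖ ≤ B₀' * ‖X‖)
    (hH1 : ∀ j, j ≤ k → ∀ (X : XSpace d k 𝔸), ∀ p ∈ Eb j, wt L η j * ‖covDerivFwd η U₀ p.2 (H' X) p.1‖ ≤ B₀' * ‖X‖)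
    (hQH : ∀ (Y : XSpace d k 𝔸) (j : ℕ) (hj : j ≤ k) (y : Site d), y ∈ Λs j →
      QprimeIter (zdBlockingZ d L) (bgTZ L U₀) j (H' Y) y = Y (⟨j, Nat.lt_succ_of_le hj⟩, y))
    (hsmall : Real.exp (4 * cZ d * α₀) * (1 + 2 * (131072 * ((d : ℝ) + 1) ^ 2) * (KZ d L) ^ 2 * c) ≤ 2)
    (hc₃ : KZ d L * c ≤ c3 d L) (hsc : 1024 * (d : ℝ) * KZ d L * c ≤ 1) (hα₃' : 20 * d * KZ d L * c ≤ 1 / 200)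
    (hs₁ : 200 * C6 d * (2 * α₄) ≤ 1) (hs₂ : 12000 * ((d : ℝ) + 1) * L * (2 * α₄) ≤ 1)
    (hs₃ : C4G d L * (α₀ + 20 * d * KZ d L * c + 4 * (2 * α₄)) ≤ 1)
    (hs₄ : 1024 * ((d : ℝ) + 1) * ((d : ℝ) + 4) * L ^ 2 * α₀ ≤ 1) (hs₅ : 32 * ((d : ℝ) + 1) ^ 2 * C6 d * L ^ 2 * α₀ ≤ 1)
    (hs₆ : 16 * d * C5' d * C6 d * (L : ℝ) ^ 2 * α₀ ≤ 1) (hs₇ : 8 * d * C6 d * L * α₀ ≤ 1)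
    (hsm : 20 * d * KZ d L * c + α₄ ≤ 1 / (4 * B₀' * (2 * C2p d)))
    (s : lamSubK η U₀ L k Eb) (hs : ‖s‖ ≤ α₄ / 4) :
    ∃ X : XSpace d k 𝔸, ‖X‖ ≤ α₄ / (2 * B₀') ∧ ‖X‖ ≤ C2p d * (20 * d * KZ d L * c + α₄) * α₄ ∧
      (∀ (j : ℕ) (hj : j ≤ k) (y : Site d), y ∉ Λs j → X (⟨j, Nat.lt_succ_of_le hj⟩, y) = 0) ∧
      (∀ (j : ℕ) (hj : j ≤ k) (y : Site d), y ∈ Λs j →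
        CnlZ L U₀ u₁⁻¹ j ((-I) • lamOf s - H' X) y = X (⟨j, Nat.lt_succ_of_le hj⟩, y)) ∧
      ∀ (j : ℕ), j ≤ k → ∀ y ∈ Λs j,
        QnlZ L U₀ (fun x => expUnit (((-I) • lamOf s - H' X) x)) u₁⁻¹ j y =
          QprimeIter (zdBlockingZ d L) (bgTZ L U₀) j ((-I) • lamOf s) y := by
  have hL1 : 1 ≤ L := by omega
  obtain ⟨h119b, h119a⟩ := ball_sub_119 (Λs := Λs) hL1 hη hα₄ hEbT s hs
  exact exists_Dprime_kLevel_inv_of_axial (Λ := Λs) (lam := (-I) • lamOf s) hLs hs1 hd hL1 hU₀ hα hα3 hα4 hc hα₄ hB hαP hαP3 hαP2 hBu h33 h69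
    hP hAx h129 h119b h119a hH0 (hH1_tower hL1 hη H' hEbT hH1) hQH hsmall hc₃ hsc hα₃' hs₁ hs₂ hs₃ hs₄ hs₅ hs₆ hs₇ hsm

/-- **`D′(u₁⁻¹, −iλ)` IS LIPSCHITZ ON THE ¼α₄-BALL WITH THE (1.102) NORM** — n04-b's `B8SectEKLevelInLambda.Dprime_lipschitz_kLevel_inv_of_axial`
(over n05-b's `B8DprimeKLevelLipschitz.Dprime_lipschitz_kLevel`) BY NAME:
any two solutions `X_s`, `X_t` of (1.117) in the ball `α₄/(2B′₀)` for `−iλ_s`, `−iλ_t` (vanishing off `𝔅_k`) satisfy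
`‖X_s − X_t‖ ≤ 4·C2p·(α₃ + 2α₄)·‖s − t‖`.  At `s = t` this is «exactly one solution» (p. 97).
[cite: Balaban1985RegularSpaces, p.97 (after (1.125)), (1.117)–(1.125) pp.96–97, (1.105)–(1.106) p.94] -/
theorem sectE_lipschitz (hLs : L = 2 * sL + 1) (hs1 : 1 ≤ sL) (hη : 0 < η) (hU₀ : ∀ x κ, U₀ x κ ∈ unitaryUnits 𝔸) (H' : XSpace d k 𝔸 →ₗ[ℂ] (Site d → 𝔸))
    (hα : 0 < α₀) (hα3 : C0Z d * α₀ ≤ 1 / 3) (hα4 : 4 * α₀ ≤ c2' d L) (hc : 0 ≤ c) (hα₄ : 0 < α₄) (hB : 0 < B₀')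
    (h33 : ∀ j, j ≤ k → ∀ y ∈ Λs j, pdevOn (tlo L y j) (thi L y j) U₀ < α₀ * (((L : ℝ) ^ j)⁻¹) ^ 2)
    (h69 : ∀ j, j ≤ k → ∀ y ∈ Λs j, ∀ (x : Site d) (κ : Fin d), InBox (tlo L y j) (thi L y j) x →
      InBox (tlo L y j) (thi L y j) (x + e κ) → ‖B x κ‖ ≤ c * ((L : ℝ) ^ j)⁻¹)
    (hd : 1 ≤ d) (hαP : 0 < αP) (hαP3 : C0Z d * αP ≤ 1 / 3) (hαP2 : 2 * αP ≤ c2' d L)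
    (hBu : ∀ (x : Site d) (κ : Fin d), expCfg B x κ ∈ unitaryUnits 𝔸)
    (hP : ∀ j, j ≤ k → ∀ y ∈ Λs j, pdevOn (tlo L y j) (thi L y j) (expCfg B * U₀) < αP * (((L : ℝ) ^ j)⁻¹) ^ 2)
    (hAx : InAxZ L k Λs U₀ (mgauge U₀ u₁ (expCfg B) * U₀)) (h129 : Restr129Z L k Λs U₀ u₁)
    (hEbT : ∀ j, j ≤ k → ∀ y ∈ Λs j, ∀ (x : Site d) (κ : Fin d), InBox (tlo L y j) (thi L y j) x →
      InBox (tlo L y j) (thi L y j) (x + e κ) → (x, κ) ∈ Eb j)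
    (hH0 : ∀ (X : XSpace d k 𝔸) (x : Site d), ‖H' X x‖ ≤ B₀' * ‖X‖)
    (hH1 : ∀ j, j ≤ k → ∀ (X : XSpace d k 𝔸), ∀ p ∈ Eb j, wt L η j * ‖covDerivFwd η U₀ p.2 (H' X) p.1‖ ≤ B₀' * ‖X‖)
    (hsmall : Real.exp (4 * cZ d * α₀) * (1 + 2 * (131072 * ((d : ℝ) + 1) ^ 2) * (KZ d L) ^ 2 * c) ≤ 2)
    (hc₃ : KZ d L * c ≤ c3 d L) (hsc : 1024 * (d : ℝ) * KZ d L * c ≤ 1) (hα₃' : 20 * d * KZ d L * c ≤ 1 / 200)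
    (hs₁ : 200 * C6 d * (2 * α₄) ≤ 1) (hs₂ : 12000 * ((d : ℝ) + 1) * L * (2 * α₄) ≤ 1)
    (hs₃ : C4G d L * (α₀ + 20 * d * KZ d L * c + 4 * (2 * α₄)) ≤ 1)
    (hs₄ : 1024 * ((d : ℝ) + 1) * ((d : ℝ) + 4) * L ^ 2 * α₀ ≤ 1) (hs₅ : 32 * ((d : ℝ) + 1) ^ 2 * C6 d * L ^ 2 * α₀ ≤ 1)
    (hs₆ : 16 * d * C5' d * C6 d * (L : ℝ) ^ 2 * α₀ ≤ 1) (hs₇ : 8 * d * C6 d * L * α₀ ≤ 1)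
    (hsm : 20 * d * KZ d L * c + α₄ ≤ 1 / (4 * B₀' * (2 * C2p d)))
    (s t : lamSubK η U₀ L k Eb) (hs : ‖s‖ ≤ α₄ / 4) (ht : ‖t‖ ≤ α₄ / 4)
    {X Y : XSpace d k 𝔸} (hXρ : ‖X‖ ≤ α₄ / (2 * B₀')) (hYρ : ‖Y‖ ≤ α₄ / (2 * B₀'))
    (hXzero : ∀ (j : ℕ) (hj : j ≤ k) (y : Site d), y ∉ Λs j → X (⟨j, Nat.lt_succ_of_le hj⟩, y) = 0)
    (hXfix : ∀ (j : ℕ) (hj : j ≤ k) (y : Site d), y ∈ Λs j →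
      CnlZ L U₀ u₁⁻¹ j ((-I) • lamOf s - H' X) y = X (⟨j, Nat.lt_succ_of_le hj⟩, y))
    (hYzero : ∀ (j : ℕ) (hj : j ≤ k) (y : Site d), y ∉ Λs j → Y (⟨j, Nat.lt_succ_of_le hj⟩, y) = 0)
    (hYfix : ∀ (j : ℕ) (hj : j ≤ k) (y : Site d), y ∈ Λs j →
      CnlZ L U₀ u₁⁻¹ j ((-I) • lamOf t - H' Y) y = Y (⟨j, Nat.lt_succ_of_le hj⟩, y)) :
    ‖X - Y‖ ≤ 4 * C2p d * (20 * d * KZ d L * c + 2 * α₄) * ‖s - t‖ := by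
  have hL1 : 1 ≤ L := by omega
  obtain ⟨h₁b, h₁a⟩ := ball_sub_119 (Λs := Λs) hL1 hη hα₄ hEbT s hs
  obtain ⟨h₂b, h₂a⟩ := ball_sub_119 (Λs := Λs) hL1 hη hα₄ hEbT t ht
  obtain ⟨hmb, hma⟩ := ball_diff_modulus (Λs := Λs) hL1 hη hEbT s t
  exact Dprime_lipschitz_kLevel_inv_of_axial (Λ := Λs) (lam₁ := (-I) • lamOf s) (lam₂ := (-I) • lamOf t) hLs hs1 hd hL1 hU₀ hα hα3 hα4 hc
    hα₄ hB (norm_nonneg _) hαP hαP3 hαP2 hBu h33 h69 hP hAx h129 h₁b h₁a h₂b h₂a hmb hma hH0 (hH1_tower hL1 hη H' hEbT hH1) hsmall hc₃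
    hsc hα₃' hs₁ hs₂ hs₃ hs₄ hs₅ hs₆ hs₇ hsm hXρ hYρ hXzero hXfix hYzero hYfix

/-- **`D′(u₁⁻¹, −iλ_s)` IS REAL FOR HERMITIAN `λ_s`** (tacit in print, where everything is `U(N)`-valued): if [3]'s remainder `C′_j(u₁⁻¹, ·)` is
covariant under `μ ↦ −μ*` on the (1.120)-set of the tower (`hCequiv`) and [4]'s `H′` under `X ↦ −X*` (`hHequiv`), then for Hermitian `λ_s` the reflected
family `−X*` solves (1.117) for the same `−iλ_s` in the same ball, so by «exactly one solution» (`sectE_lipschitz` at `s = t`) `X(j, y)* = −X(j, y)`.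
[cite: Balaban1985RegularSpaces, p.97 (exactly one solution), p.93 (real configurations); Balaban1985Averaging, (22)–(23) p.21, (208) p.50] -/
theorem sectE_real (hLs : L = 2 * sL + 1) (hs1 : 1 ≤ sL) (hη : 0 < η) (hU₀ : ∀ x κ, U₀ x κ ∈ unitaryUnits 𝔸) (H' : XSpace d k 𝔸 →ₗ[ℂ] (Site d → 𝔸))
    (hα : 0 < α₀) (hα3 : C0Z d * α₀ ≤ 1 / 3) (hα4 : 4 * α₀ ≤ c2' d L) (hc : 0 ≤ c) (hα₄ : 0 < α₄) (hB : 0 < B₀')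
    (h33 : ∀ j, j ≤ k → ∀ y ∈ Λs j, pdevOn (tlo L y j) (thi L y j) U₀ < α₀ * (((L : ℝ) ^ j)⁻¹) ^ 2)
    (h69 : ∀ j, j ≤ k → ∀ y ∈ Λs j, ∀ (x : Site d) (κ : Fin d), InBox (tlo L y j) (thi L y j) x →
      InBox (tlo L y j) (thi L y j) (x + e κ) → ‖B x κ‖ ≤ c * ((L : ℝ) ^ j)⁻¹)
    (hd : 1 ≤ d) (hαP : 0 < αP) (hαP3 : C0Z d * αP ≤ 1 / 3) (hαP2 : 2 * αP ≤ c2' d L)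
    (hBu : ∀ (x : Site d) (κ : Fin d), expCfg B x κ ∈ unitaryUnits 𝔸)
    (hP : ∀ j, j ≤ k → ∀ y ∈ Λs j, pdevOn (tlo L y j) (thi L y j) (expCfg B * U₀) < αP * (((L : ℝ) ^ j)⁻¹) ^ 2)
    (hAx : InAxZ L k Λs U₀ (mgauge U₀ u₁ (expCfg B) * U₀)) (h129 : Restr129Z L k Λs U₀ u₁)
    (hEbT : ∀ j, j ≤ k → ∀ y ∈ Λs j, ∀ (x : Site d) (κ : Fin d), InBox (tlo L y j) (thi L y j) x →
      InBox (tlo L y j) (thi L y j) (x + e κ) → (x, κ) ∈ Eb j)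
    (hH0 : ∀ (X : XSpace d k 𝔸) (x : Site d), ‖H' X x‖ ≤ B₀' * ‖X‖)
    (hH1 : ∀ j, j ≤ k → ∀ (X : XSpace d k 𝔸), ∀ p ∈ Eb j, wt L η j * ‖covDerivFwd η U₀ p.2 (H' X) p.1‖ ≤ B₀' * ‖X‖)
    (hHequiv : ∀ X Y : XSpace d k 𝔸, (∀ p, Y p = -star (X p)) → ∀ x, H' Y x = -star (H' X x))
    (hCequiv : ∀ j, j ≤ k → ∀ y ∈ Λs j, ∀ μ : Site d → 𝔸,
      (∀ x : Site d, InBox (tlo L y j) (thi L y j) x → ‖μ x‖ < α₄) →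
      (∀ (x : Site d) (κ : Fin d), InBox (tlo L y j) (thi L y j) x → InBox (tlo L y j) (thi L y j) (x + e κ) →
        ‖cj (U₀ x κ) (μ (x + e κ)) - μ x‖ < α₄ * ((L : ℝ) ^ j)⁻¹) →
      CnlZ L U₀ u₁⁻¹ j (fun x => -star (μ x)) y = -star (CnlZ L U₀ u₁⁻¹ j μ y))
    (hsmall : Real.exp (4 * cZ d * α₀) * (1 + 2 * (131072 * ((d : ℝ) + 1) ^ 2) * (KZ d L) ^ 2 * c) ≤ 2)
    (hc₃ : KZ d L * c ≤ c3 d L) (hsc : 1024 * (d : ℝ) * KZ d L * c ≤ 1) (hα₃' : 20 * d * KZ d L * c ≤ 1 / 200)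
    (hs₁ : 200 * C6 d * (2 * α₄) ≤ 1) (hs₂ : 12000 * ((d : ℝ) + 1) * L * (2 * α₄) ≤ 1)
    (hs₃ : C4G d L * (α₀ + 20 * d * KZ d L * c + 4 * (2 * α₄)) ≤ 1)
    (hs₄ : 1024 * ((d : ℝ) + 1) * ((d : ℝ) + 4) * L ^ 2 * α₀ ≤ 1) (hs₅ : 32 * ((d : ℝ) + 1) ^ 2 * C6 d * L ^ 2 * α₀ ≤ 1)
    (hs₆ : 16 * d * C5' d * C6 d * (L : ℝ) ^ 2 * α₀ ≤ 1) (hs₇ : 8 * d * C6 d * L * α₀ ≤ 1)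
    (hsm : 20 * d * KZ d L * c + α₄ ≤ 1 / (4 * B₀' * (2 * C2p d)))
    (s : lamSubK η U₀ L k Eb) (hs : ‖s‖ ≤ α₄ / 4) (hsa : ∀ x, IsSelfAdjoint (lamOf s x))
    {X : XSpace d k 𝔸} (hXρ : ‖X‖ ≤ α₄ / (2 * B₀'))
    (hXzero : ∀ (j : ℕ) (hj : j ≤ k) (y : Site d), y ∉ Λs j → X (⟨j, Nat.lt_succ_of_le hj⟩, y) = 0)
    (hXfix : ∀ (j : ℕ) (hj : j ≤ k) (y : Site d), y ∈ Λs j →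
      CnlZ L U₀ u₁⁻¹ j ((-I) • lamOf s - H' X) y = X (⟨j, Nat.lt_succ_of_le hj⟩, y)) :
    ∀ p, star (X p) = -X p := by
  have hL1 : 1 ≤ L := by omega
  -- the reflected family `−X*`
  have hbd : ∀ p, ‖-star (X p)‖ ≤ ‖X‖ := fun p => by
    rw [norm_neg, norm_star]; exact X.norm_coe_le_norm p
  set Y : XSpace d k 𝔸 := BoundedContinuousFunction.ofNormedAddCommGroupDiscrete (fun p => -star (X p)) ‖X‖ hbd with hYdef
  have hYp : ∀ p, Y p = -star (X p) := fun p => rfl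
  have hYρ : ‖Y‖ ≤ α₄ / (2 * B₀') :=
    ((BoundedContinuousFunction.norm_le (norm_nonneg X)).2 fun p => by rw [hYp]; exact hbd p).trans hXρ
  have hYzero : ∀ (j : ℕ) (hj : j ≤ k) (y : Site d), y ∉ Λs j → Y (⟨j, Nat.lt_succ_of_le hj⟩, y) = 0 := fun j hj y hy => by
    rw [hYp, hXzero j hj y hy, star_zero, neg_zero]
  have hHY : H' Y = fun x => -star (H' X x) := funext (hHequiv X Y hYp)
  have hμ : (-I) • lamOf s - H' Y = fun x => -star (((-I) • lamOf s - H' X) x) := by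
    funext x
    rw [hHY, Pi.sub_apply, Pi.smul_apply, Pi.sub_apply, Pi.smul_apply, star_sub, star_negI_smul_of_sa (hsa x)]
    abel
  have hYfix : ∀ (j : ℕ) (hj : j ≤ k) (y : Site d), y ∈ Λs j →
      CnlZ L U₀ u₁⁻¹ j ((-I) • lamOf s - H' Y) y = Y (⟨j, Nat.lt_succ_of_le hj⟩, y) := by
    intro j hj y hy
    obtain ⟨h119b, h119a⟩ := ball_sub_119 (Λs := Λs) hL1 hη hα₄ hEbT s hs
    obtain ⟨ha, hb⟩ := dom120_of_119_tower H' hB (by positivity) hH0 ((hH1_tower hL1 hη H' hEbT hH1) j hj y hy) (h119a j hj y hy)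
      (h119b j hj y hy) hXρ
    rw [hμ, hCequiv j hj y hy _ hb ha, hXfix j hj y hy, hYp]
  have hXY := sectE_lipschitz hLs hs1 hη hU₀ H' hα hα3 hα4 hc hα₄ hB h33 h69 hd hαP hαP3 hαP2 hBu hP hAx h129 hEbT hH0 hH1 hsmall hc₃ hsc hα₃' hs₁ hs₂ hs₃
    hs₄ hs₅ hs₆ hs₇ hsm s s hs hs hXρ hYρ hXzero hXfix hYzero hYfix
  rw [sub_self, norm_zero, mul_zero] at hXY
  have hXYeq : X = Y := sub_eq_zero.1 (norm_le_zero_iff.1 hXY)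
  intro p
  have h1 : X p = -star (X p) := by rw [← hYp p, ← hXYeq]
  have h2 := congrArg star h1
  rw [star_neg, star_star] at h2
  exact h2

end SectE

/-! ## §3 JOIN-C: Proposition 5's fixed point in the knit's currency with `H_c := −iH′D′(u₁⁻¹, −i·)` from Sect. E -/

section Join

variable {L sL k : ℕ} {η β : ℝ} {Ω Λs : ℕ → Set (Site d)} {Eb : ℕ → Set (Site d × Fin d)} {U₀ : Site d → Fin d → 𝔸ˣ}
  {A : Site d → Fin d → 𝔸} {u₁ : Site d → 𝔸ˣ}

/-- **THE MAP `λ ↦ D′(u₁⁻¹, −iλ)` ON THE ¼α₄-BALL, CHOSEN ONCE** (p. 97 «We take D′(λ) equal to this solution»): a function `Dp` on site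
functions with, for every `s` in the ¼α₄-ball of (1.102): `Dp λ_s` in the ball `α₄/(2B′₀)`, vanishing off `𝔅_k`, solving (1.117) for `−iλ_s`, of size
`≤ C2p(α₃ + α₄)α₄`, with (1.114) for the inverse pair; Lipschitz `‖Dp λ_s − Dp λ_t‖ ≤ 4C2p(α₃ + 2α₄)‖s − t‖`; and `(Dp λ_s)* = −Dp λ_s` for Hermitian `λ_s`
(`sectE_exists` / `sectE_lipschitz` / `sectE_real`; the choice is by `Classical.choice`, unique by «exactly one solution»).
[cite: Balaban1985RegularSpaces, (1.113)–(1.121) pp.95–97, p.97 (exactly one solution; analytic function of λ)] -/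
theorem exists_Dprime_map (hLs : L = 2 * sL + 1) (hs1 : 1 ≤ sL) (hη : 0 < η) (hU₀ : ∀ x κ, U₀ x κ ∈ unitaryUnits 𝔸) (H' : XSpace d k 𝔸 →ₗ[ℂ] (Site d → 𝔸))
    {B : Site d → Fin d → 𝔸} {α₀ αP α₄ cB B₀' : ℝ}
    (hα : 0 < α₀) (hα3 : C0Z d * α₀ ≤ 1 / 3) (hα4 : 4 * α₀ ≤ c2' d L) (hcB : 0 ≤ cB) (hα₄ : 0 < α₄) (hB : 0 < B₀')
    (h33 : ∀ j, j ≤ k → ∀ y ∈ Λs j, pdevOn (tlo L y j) (thi L y j) U₀ < α₀ * (((L : ℝ) ^ j)⁻¹) ^ 2)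
    (h69 : ∀ j, j ≤ k → ∀ y ∈ Λs j, ∀ (x : Site d) (κ : Fin d), InBox (tlo L y j) (thi L y j) x →
      InBox (tlo L y j) (thi L y j) (x + e κ) → ‖B x κ‖ ≤ cB * ((L : ℝ) ^ j)⁻¹)
    (hd : 1 ≤ d) (hαP : 0 < αP) (hαP3 : C0Z d * αP ≤ 1 / 3) (hαP2 : 2 * αP ≤ c2' d L)
    (hBu : ∀ (x : Site d) (κ : Fin d), expCfg B x κ ∈ unitaryUnits 𝔸)
    (hP : ∀ j, j ≤ k → ∀ y ∈ Λs j, pdevOn (tlo L y j) (thi L y j) (expCfg B * U₀) < αP * (((L : ℝ) ^ j)⁻¹) ^ 2)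
    (hAx : InAxZ L k Λs U₀ (mgauge U₀ u₁ (expCfg B) * U₀)) (h129 : Restr129Z L k Λs U₀ u₁)
    (hEbT : ∀ j, j ≤ k → ∀ y ∈ Λs j, ∀ (x : Site d) (κ : Fin d), InBox (tlo L y j) (thi L y j) x →
      InBox (tlo L y j) (thi L y j) (x + e κ) → (x, κ) ∈ Eb j)
    (hH0 : ∀ (X : XSpace d k 𝔸) (x : Site d), ‖H' X x‖ ≤ B₀' * ‖X‖)
    (hH1 : ∀ j, j ≤ k → ∀ (X : XSpace d k 𝔸), ∀ p ∈ Eb j, wt L η j * ‖covDerivFwd η U₀ p.2 (H' X) p.1‖ ≤ B₀' * ‖X‖)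
    (hHequiv : ∀ X Y : XSpace d k 𝔸, (∀ p, Y p = -star (X p)) → ∀ x, H' Y x = -star (H' X x))
    (hQH : ∀ (Y : XSpace d k 𝔸) (j : ℕ) (hj : j ≤ k) (y : Site d), y ∈ Λs j →
      QprimeIter (zdBlockingZ d L) (bgTZ L U₀) j (H' Y) y = Y (⟨j, Nat.lt_succ_of_le hj⟩, y))
    (hCequiv : ∀ j, j ≤ k → ∀ y ∈ Λs j, ∀ μ : Site d → 𝔸,
      (∀ x : Site d, InBox (tlo L y j) (thi L y j) x → ‖μ x‖ < α₄) →
      (∀ (x : Site d) (κ : Fin d), InBox (tlo L y j) (thi L y j) x → InBox (tlo L y j) (thi L y j) (x + e κ) →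
        ‖cj (U₀ x κ) (μ (x + e κ)) - μ x‖ < α₄ * ((L : ℝ) ^ j)⁻¹) →
      CnlZ L U₀ u₁⁻¹ j (fun x => -star (μ x)) y = -star (CnlZ L U₀ u₁⁻¹ j μ y))
    (hsmall : Real.exp (4 * cZ d * α₀) * (1 + 2 * (131072 * ((d : ℝ) + 1) ^ 2) * (KZ d L) ^ 2 * cB) ≤ 2)
    (hc₃ : KZ d L * cB ≤ c3 d L) (hsc : 1024 * (d : ℝ) * KZ d L * cB ≤ 1) (hα₃' : 20 * d * KZ d L * cB ≤ 1 / 200)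
    (hs₁ : 200 * C6 d * (2 * α₄) ≤ 1) (hs₂ : 12000 * ((d : ℝ) + 1) * L * (2 * α₄) ≤ 1)
    (hs₃ : C4G d L * (α₀ + 20 * d * KZ d L * cB + 4 * (2 * α₄)) ≤ 1)
    (hs₄ : 1024 * ((d : ℝ) + 1) * ((d : ℝ) + 4) * L ^ 2 * α₀ ≤ 1) (hs₅ : 32 * ((d : ℝ) + 1) ^ 2 * C6 d * L ^ 2 * α₀ ≤ 1)
    (hs₆ : 16 * d * C5' d * C6 d * (L : ℝ) ^ 2 * α₀ ≤ 1) (hs₇ : 8 * d * C6 d * L * α₀ ≤ 1)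
    (hsm : 20 * d * KZ d L * cB + α₄ ≤ 1 / (4 * B₀' * (2 * C2p d))) :
    ∃ Dp : (Site d → 𝔸) → XSpace d k 𝔸,
      (∀ s : lamSubK η U₀ L k Eb, ‖s‖ ≤ α₄ / 4 →
        ‖Dp (lamOf s)‖ ≤ α₄ / (2 * B₀') ∧ ‖Dp (lamOf s)‖ ≤ C2p d * (20 * d * KZ d L * cB + α₄) * α₄ ∧
        (∀ (j : ℕ) (hj : j ≤ k) (y : Site d), y ∉ Λs j → Dp (lamOf s) (⟨j, Nat.lt_succ_of_le hj⟩, y) = 0) ∧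
        (∀ (j : ℕ) (hj : j ≤ k) (y : Site d), y ∈ Λs j →
          CnlZ L U₀ u₁⁻¹ j ((-I) • lamOf s - H' (Dp (lamOf s))) y = Dp (lamOf s) (⟨j, Nat.lt_succ_of_le hj⟩, y)) ∧
        ∀ (j : ℕ), j ≤ k → ∀ y ∈ Λs j,
          QnlZ L U₀ (fun x => expUnit (((-I) • lamOf s - H' (Dp (lamOf s))) x)) u₁⁻¹ j y =
            QprimeIter (zdBlockingZ d L) (bgTZ L U₀) j ((-I) • lamOf s) y) ∧
      (∀ s t : lamSubK η U₀ L k Eb, ‖s‖ ≤ α₄ / 4 → ‖t‖ ≤ α₄ / 4 →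
        ‖Dp (lamOf s) - Dp (lamOf t)‖ ≤ 4 * C2p d * (20 * d * KZ d L * cB + 2 * α₄) * ‖s - t‖) ∧
      ∀ s : lamSubK η U₀ L k Eb, ‖s‖ ≤ α₄ / 4 → (∀ x, IsSelfAdjoint (lamOf s x)) → ∀ p, star (Dp (lamOf s) p) = -Dp (lamOf s) p := by
  -- a solution with all the listed properties at each λ_s of the ball, chosen once
  have key : ∀ lam : Site d → 𝔸, ∃ X : XSpace d k 𝔸, ∀ s : lamSubK η U₀ L k Eb, lamOf s = lam → ‖s‖ ≤ α₄ / 4 →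
      ‖X‖ ≤ α₄ / (2 * B₀') ∧ ‖X‖ ≤ C2p d * (20 * d * KZ d L * cB + α₄) * α₄ ∧
      (∀ (j : ℕ) (hj : j ≤ k) (y : Site d), y ∉ Λs j → X (⟨j, Nat.lt_succ_of_le hj⟩, y) = 0) ∧
      (∀ (j : ℕ) (hj : j ≤ k) (y : Site d), y ∈ Λs j →
        CnlZ L U₀ u₁⁻¹ j ((-I) • lamOf s - H' X) y = X (⟨j, Nat.lt_succ_of_le hj⟩, y)) ∧
      ∀ (j : ℕ), j ≤ k → ∀ y ∈ Λs j,
        QnlZ L U₀ (fun x => expUnit (((-I) • lamOf s - H' X) x)) u₁⁻¹ j y = QprimeIter (zdBlockingZ d L) (bgTZ L U₀) j ((-I) • lamOf s) y := by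
    intro lam
    by_cases h : ∃ s : lamSubK η U₀ L k Eb, lamOf s = lam ∧ ‖s‖ ≤ α₄ / 4
    · obtain ⟨s, rfl, hs⟩ := h
      obtain ⟨X, hX⟩ := sectE_exists hLs hs1 hη hU₀ H' hα hα3 hα4 hcB hα₄ hB h33 h69 hd hαP hαP3 hαP2 hBu hP hAx h129 hEbT hH0 hH1 hQH hsmall hc₃ hsc hα₃' hs₁ hs₂
        hs₃ hs₄ hs₅ hs₆ hs₇ hsm s hs
      refine ⟨X, fun t ht _ => ?_⟩
      rw [B8LambdaSpaceKLevel.ext_of_lamOf ht]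
      exact hX
    · exact ⟨0, fun s h1 h2 => absurd ⟨s, h1, h2⟩ h⟩
  choose Dp hDp' using key
  have hDp := fun (s : lamSubK η U₀ L k Eb) (hs : ‖s‖ ≤ α₄ / 4) => hDp' (lamOf s) s rfl hs
  refine ⟨Dp, hDp, fun s t hs ht => ?_, fun s hs hsa => ?_⟩
  · exact sectE_lipschitz hLs hs1 hη hU₀ H' hα hα3 hα4 hcB hα₄ hB h33 h69 hd hαP hαP3 hαP2 hBu hP hAx h129 hEbT hH0 hH1 hsmall hc₃ hsc hα₃' hs₁ hs₂ hs₃ hs₄ hs₅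
      hs₆ hs₇ hsm s t hs ht (hDp s hs).1 (hDp t ht).1 (hDp s hs).2.2.1 (hDp s hs).2.2.2.1 (hDp t ht).2.2.1 (hDp t ht).2.2.2.1
  · exact sectE_real hLs hs1 hη hU₀ H' hα hα3 hα4 hcB hα₄ hB h33 h69 hd hαP hαP3 hαP2 hBu hP hAx h129 hEbT hH0 hH1 hHequiv hCequiv hsmall hc₃ hsc hα₃' hs₁ hs₂ hs₃
      hs₄ hs₅ hs₆ hs₇ hsm s hs hsa (hDp s hs).1 (hDp s hs).2.2.1 (hDp s hs).2.2.2.1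

end Join


/-! ## §4 The LOCAL inversion route: (1.29) for `u₁·e^{iλ′}` from «`Q′(u₁⁻¹, λ_E − H′D′) = 0`» with `pub-ymgap-dag-n04-b`'s
tower-local `B8Restr129InversionLocal` (no global (167), no `hdom`, no `Restr129 … u₁⁻¹`) -/

section Local

open B7Prop1Local (clampCfg)
open B8Eq1117KLevelRec (glevZ_on_towers_of_axial)
open B8SectEInLambdaWitnessRec (witness_unitary_of_glevZ)
open B8Restr129InversionLocalRec (restr129_mul_inv_of_cond179_local)
open B8Prop5GaugeParamKLevel (gaugeParam_kLevel gpar_size)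
open B8Prop5ContractionKLevel (Zsol Vop Wsrc PsiP5)
open B8Prop5KLevelLetters (multiplier_iff_of_whyZ)
open B8Eq195Linear (eq_g_proj325_iff proj325_sub)
open B8Eq188Proof (gAd_neg)
open B8Prop5JoinHFP (covLap_neg')

variable {L sL k : ℕ} {η : ℝ} {Ω Λs : ℕ → Set (Site d)} {Eb : ℕ → Set (Site d × Fin d)} {U₀ : Site d → Fin d → 𝔸ˣ}
  {A : Site d → Fin d → 𝔸} {u₁ : Site d → 𝔸ˣ}

/-- **(1.29) FOR `u₁·e^{iλ′}` BY THE LOCAL INVERSION ROUTE** (n04-b's `B8Restr129InversionLocal.restr129_mul_inv_of_cond179_local` BY NAME, with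
its unitary `Λ_j`-witnesses supplied by `B8SectEInLambdaWitness.witness_unitary_of_glev` ∘ `B8Eq1117KLevel.glev_on_towers_of_axial` from the
datum's (1.34) `InAx` and (1.29) `Restr129` for `u₁`): for `λ′ = λ_s + H_cλ_s` on the ¼α₄-ball, `H_c` with sup-size `h₀ ≤ ¾α₄` and
`Eb`-gradient size `h₁ ≤ ¾α₄`, the (207)-bounds of `−iλ′` on the towers hold at `2α₄`, so «`Q′(u₁⁻¹, e^{−iλ′}) = 0` on `𝔅_k`» (`Cond179`) gives
`Restr129 L k Λ U₀ (u₁ · e^{iλ′})`.  Regime: unitary data, (1.33) on the towers, (1.69) `|B_b| ≤ c_B L^{−j}` with `e^B` unitary and the plaquette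
regularity of `e^B U₀`, tower bonds in `Eb j`, windows `2048·d·c_B ≤ 1`, `40d·c_B ≤ 1/200`, r04's Prop-10 windows at `8α₄` and
`2C₆(40d·c_B + 8α₄) < ½`.  No hypothesis at `u₁⁻¹`, nothing global.
[cite: Balaban1985RegularSpaces, (1.29) p.81, (1.78)–(1.79) p.90, (1.108) p.94, (1.112)–(1.113) p.95; Balaban1985Averaging, Prop. 10 (203)–(204) p.50] -/
theorem restr129_mul_gaugeExp_local (hLs : L = 2 * sL + 1) (hs1 : 1 ≤ sL) (hη : 0 < η) (hd : 1 ≤ d) (hU₀ : ∀ x κ, U₀ x κ ∈ unitaryUnits 𝔸)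
    (hEbT : ∀ j, j ≤ k → ∀ y ∈ Λs j, ∀ (x : Site d) (κ : Fin d), InBox (tlo L y j) (thi L y j) x →
      InBox (tlo L y j) (thi L y j) (x + e κ) → (x, κ) ∈ Eb j)
    {B : Site d → Fin d → 𝔸} {α₀ αP α₄ cB h₀ h₁ : ℝ}
    (hα : 0 < α₀) (hα3 : C0Z d * α₀ ≤ 1 / 3) (hα4 : 4 * α₀ ≤ c2' d L) (hcB : 0 ≤ cB) (hα₄ : 0 < α₄)
    (hαP : 0 < αP) (hαP3 : C0Z d * αP ≤ 1 / 3) (hαP2 : 2 * αP ≤ c2' d L)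
    (hBu : ∀ (x : Site d) (κ : Fin d), expCfg B x κ ∈ unitaryUnits 𝔸)
    (h33 : ∀ j, j ≤ k → ∀ y ∈ Λs j, pdevOn (tlo L y j) (thi L y j) U₀ < α₀ * (((L : ℝ) ^ j)⁻¹) ^ 2)
    (h69 : ∀ j, j ≤ k → ∀ y ∈ Λs j, ∀ (x : Site d) (κ : Fin d), InBox (tlo L y j) (thi L y j) x →
      InBox (tlo L y j) (thi L y j) (x + e κ) → ‖B x κ‖ ≤ cB * ((L : ℝ) ^ j)⁻¹)
    (hP : ∀ j, j ≤ k → ∀ y ∈ Λs j, pdevOn (tlo L y j) (thi L y j) (expCfg B * U₀) < αP * (((L : ℝ) ^ j)⁻¹) ^ 2)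
    (hAx : InAxZ L k Λs U₀ (mgauge U₀ u₁ (expCfg B) * U₀)) (h129 : Restr129Z L k Λs U₀ u₁)
    (hsmall : Real.exp (4 * cZ d * α₀) * (1 + 2 * (131072 * ((d : ℝ) + 1) ^ 2) * (KZ d L) ^ 2 * cB) ≤ 2)
    (hc₃ : KZ d L * cB ≤ c3 d L) (hsc : 1024 * (d : ℝ) * KZ d L * cB ≤ 1) (hα₃' : 20 * d * KZ d L * cB ≤ 1 / 200)
    (hw₁ : 10 * C6 d * (4 * (2 * α₄)) ≤ 1) (hw₂ : 3000 * ((d : ℝ) + 1) * L * (4 * (2 * α₄)) ≤ 1)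
    (hw₃ : C4G d L * (α₀ + 20 * d * KZ d L * cB + 4 * (2 * α₄)) ≤ 1)
    (hw₄ : 1024 * ((d : ℝ) + 1) * ((d : ℝ) + 4) * L ^ 2 * α₀ ≤ 1) (hw₅ : 32 * ((d : ℝ) + 1) ^ 2 * C6 d * L ^ 2 * α₀ ≤ 1)
    (hw₆ : 16 * d * C5' d * C6 d * (L : ℝ) ^ 2 * α₀ ≤ 1) (hprod : 2 * C6 d * (20 * d * KZ d L * cB + 4 * (2 * α₄)) < 1 / 2)
    -- the correction H_c: sup and Eb-gradient sizes on the ¼α₄-ball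
    (Hc : (Site d → 𝔸) → (Site d → 𝔸)) (hh₀' : h₀ ≤ 3 * α₄ / 4) (hh₁' : h₁ ≤ 3 * α₄ / 4)
    (hc0 : ∀ s : lamSubK η U₀ L k Eb, ‖s‖ ≤ α₄ / 4 → ∀ x, ‖Hc (lamOf s) x‖ ≤ h₀)
    (hc1 : ∀ s : lamSubK η U₀ L k Eb, ‖s‖ ≤ α₄ / 4 → ∀ j, j ≤ k → ∀ p ∈ Eb j, wt L η j * ‖covDerivFwd η U₀ p.2 (Hc (lamOf s)) p.1‖ ≤ h₁)
    (s : lamSubK η U₀ L k Eb) (hs : ‖s‖ ≤ α₄ / 4)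
    (h179' : Cond179Z L k Λs U₀ (fun x => expUnit (((-I) • (lamOf s + Hc (lamOf s))) x)) u₁⁻¹) :
    Restr129Z L k Λs U₀ (u₁ * gaugeExp (lamOf s + Hc (lamOf s))) := by
  have hL1 : 1 ≤ L := by omega
  have hα₃ : (0 : ℝ) ≤ 20 * d * KZ d L * cB := alpha3Z_nonneg L hcB
  set lam' := lamOf s + Hc (lamOf s) with hlam'
  -- unitary Λ_j-witnesses for u₁ at every point of 𝔅_k
  have hwit : ∀ j, j ≤ k → ∀ y ∈ Λs j, ∃ ut : Site d → 𝔸ˣ, (∀ x, ut x ∈ unitaryUnits 𝔸) ∧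
      InLambdaZ L (clampCfg (tlo L y j) (thi L y j) U₀) ut j (20 * d * KZ d L * cB) (((L : ℝ) ^ j)⁻¹) ∧
      ∀ x : Site d, tlo L y j ≤ x → x ≤ thi L y j → u₁ x = ut x := fun j hj y hy =>
    witness_unitary_of_glevZ hLs hs1 hd hU₀ hα hα3 hα4 (h33 j hj y hy) hcB hsmall hc₃ hsc hαP hαP3 hαP2 hL1 hBu (h69 j hj y hy) (hP j hj y hy)
      (glevZ_on_towers_of_axial hLs hL1 Λs hAx h129 j hj y hy)
  -- (207) for −iλ′ on the towers at 2α₄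
  have h177b : ∀ j, j ≤ k → ∀ y ∈ Λs j, ∀ x : Site d, InBox (tlo L y j) (thi L y j) x → ‖((-I) • lam') x‖ < 2 * α₄ := by
    intro j _ y _ x _
    rw [Pi.smul_apply, norm_negI_smul]
    exact (gpar_size hc0 s hs x).trans_lt (by linarith)
  have h177a : ∀ j, j ≤ k → ∀ y ∈ Λs j, ∀ (x : Site d) (κ : Fin d), InBox (tlo L y j) (thi L y j) x →
      InBox (tlo L y j) (thi L y j) (x + e κ) → ‖cj (U₀ x κ) (((-I) • lam') (x + e κ)) - ((-I) • lam') x‖ < 2 * α₄ * ((L : ℝ) ^ j)⁻¹ := by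
    intro j hj y hy x κ hx hxe
    have hLj : (0 : ℝ) < ((L : ℝ) ^ j)⁻¹ := by
      have : (0 : ℝ) < L := by exact_mod_cast hL1
      positivity
    have hb : (x, κ) ∈ Eb j := hEbT j hj y hy x κ hx hxe
    have hgrad : wt L η j * ‖covDerivFwd η U₀ κ lam' x‖ ≤ α₄ / 4 + h₁ := by
      have h1 : wt L η j * ‖covDerivFwd η U₀ κ (lamOf s) x‖ ≤ ‖s‖ := weight_mul_norm_covDerivFwd_le hη.le s hj hb
      have h2 : wt L η j * ‖covDerivFwd η U₀ κ (Hc (lamOf s)) x‖ ≤ h₁ := hc1 s hs j hj (x, κ) hb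
      have hw : 0 ≤ wt L η j := wt_nonneg L hη.le j
      have h3 : ‖covDerivFwd η U₀ κ lam' x‖ ≤ ‖covDerivFwd η U₀ κ (lamOf s) x‖ + ‖covDerivFwd η U₀ κ (Hc (lamOf s)) x‖ := by
        rw [hlam', B8LambdaSpaceKLevel.covDerivFwd_add']; exact norm_add_le _ _
      have h4 := mul_le_mul_of_nonneg_left h3 hw
      rw [mul_add] at h4
      linarith only [h4, h1, h2, hs]
    rw [Pi.smul_apply, Pi.smul_apply, cj_smul_complex, ← smul_sub, norm_negI_smul]
    calc ‖cj (U₀ x κ) (lam' (x + e κ)) - lam' x‖ ≤ (α₄ / 4 + h₁) * ((L : ℝ) ^ j)⁻¹ := cjDiff_le_of_weighted hL1 hη hgrad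
      _ < 2 * α₄ * ((L : ℝ) ^ j)⁻¹ := mul_lt_mul_of_pos_right (by linarith) hLj
  have h := restr129_mul_inv_of_cond179_local (Λ := Λs) (lam := (-I) • lam') hLs hs1 hd hL1 hU₀ hα hα3 hα4 hα₃ (by linarith) (by positivity)
    h33 hwit h177b h177a hw₁ hw₂ hw₃ hw₄ hw₅ hw₆ hprod h129 h179'
  have hfun : (fun x => expUnit (((-I) • lam') x))⁻¹ = gaugeExp lam' := by
    funext x
    rw [Pi.inv_apply, val_inv_expUnit, Pi.smul_apply, neg_smul, neg_neg]
    rfl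
  rw [hfun] at h
  exact h

end Local


/-! ## §5 (1.114) for the inverse pair + `Q′λ_s = 0` ⇒ (1.79), in the shape the local route consumes -/

section JoinLocal

variable {L sL k : ℕ} {η : ℝ} {Ω Λs : ℕ → Set (Site d)} {Eb : ℕ → Set (Site d × Fin d)} {U₀ : Site d → Fin d → 𝔸ˣ}
  {A : Site d → Fin d → 𝔸} {u₁ : Site d → 𝔸ˣ}

omit [Nontrivial 𝔸] in
/-- (1.114) for the inverse pair + `Q′λ_s = 0` ⇒ «`Q′(u₁⁻¹, e^{−iλ′}) = 0` on `𝔅_k`» with `λ′ = λ_s − iH′X` written as `e^{−i(λ_s + (−i)H′X)}`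
(the shape `hFP_kLevel_of179_local` consumes): `−i(λ_s − iH′X) = −iλ_s − H′X` pointwise. [cite: Balaban1985RegularSpaces, (1.113)–(1.114) p.95, (1.79) p.90] -/
theorem cond179_of_eq114' (H' : XSpace d k 𝔸 →ₗ[ℂ] (Site d → 𝔸)) (q : (Site d → 𝔸) →ₗ[ℂ] (ℕ → Site d → 𝔸))
    (hq : ∀ (f : Site d → 𝔸) (j : ℕ), j ≤ k → ∀ y ∈ Λs j, q f j y = QprimeIter (zdBlockingZ d L) (bgTZ L U₀) j f y)
    (s : lamSubK η U₀ L k Eb) {X : XSpace d k 𝔸}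
    (he114 : ∀ (j : ℕ), j ≤ k → ∀ y ∈ Λs j,
      QnlZ L U₀ (fun x => expUnit (((-I) • lamOf s - H' X) x)) u₁⁻¹ j y = QprimeIter (zdBlockingZ d L) (bgTZ L U₀) j ((-I) • lamOf s) y)
    (hq0 : q (lamOf s) = 0) :
    Cond179Z L k Λs U₀ (fun x => expUnit (((-I) • (lamOf s + (-I) • H' X)) x)) u₁⁻¹ := by
  have hfun : (fun x => expUnit (((-I) • (lamOf s + (-I) • H' X)) x)) = fun x => expUnit (((-I) • lamOf s - H' X) x) := by
    funext x
    congr 1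
    rw [Pi.smul_apply, Pi.add_apply, Pi.smul_apply, smul_add, smul_smul, Pi.sub_apply, Pi.smul_apply, sub_eq_add_neg]
    congr 1
    rw [show (-I) * (-I) = (-1 : ℂ) by rw [neg_mul_neg, Complex.I_mul_I], neg_one_smul]
  intro j hj y hy
  rw [hfun, he114 j hj y hy]
  have h := congrFun (QprimeIter_smul (zdBlockingZ d L) (bgTZ L U₀) (-I) (lamOf s) j) y
  rw [show ((-I) • lamOf s : Site d → 𝔸) = fun x => (-I) • lamOf s x from rfl, h, ← hq _ j hj y hy, hq0, Pi.zero_apply,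
    Pi.zero_apply, smul_zero]

end JoinLocal

end Literature.MathematicalPhysics.QuantumFieldTheory.Balaban1983to89.B8Prop5JoinSectERec

end
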